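import Summits.BirchSwinnertonDyer.BirchSwinnertonDyer.Theorems.SignedLowerHalvesSmallImageLowerHalfBothSignsRttD2SpecialisationDefs
import Summits.BirchSwinnertonDyer.BirchSwinnertonDyer.Theorems.SignedLowerHalvesSmallImageLowerHalfBothSignsRttD2LambdaSpecialisationO
import HarnessLib

/-!
# Route `SignedLowerHalves`, crux L `SmallImageLowerHalfBothSigns` (item stmt-BirchSwinnertonDyer-23599), line `rtt_w3` v13 — E2, row D2: the specialised zeta
# module is CYCLIC on one `_𝔞ζ` as soon as `φ(N𝔞 − σ_𝔞)` is a unit of `𝒪⟦T⟧` — the hypothesis `hz : (D.Z).map mk = R∙(zetaSp f D a)` of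
# `…RttD2SpecialisationHKCyclic` from JLK's independence relation `(N𝔟 − σ_𝔟)·_𝔞ζ = (N𝔞 − σ_𝔞)·_𝔟ζ`

Width seat `bsd-line-slh-p3-w3` g19 under LEAD `cruxlead-stmt-BirchSwinnertonDyer-23599` g9 (D2 DEFINER); ROUTE-INDEPENDENT helper (`--supports
stmt-BirchSwinnertonDyer-23599`); THEOREMS ONLY — no definition, no named fact, no instance, no `sorry`; closes nothing; BSD is not proved by any of this.

`𝒪` any commutative ring, `R = 𝒪⟦T₂⟧⟦T₁⟧`, `f = C (X − C b)`, `φ : R →+* 𝒪⟦T⟧` with `φ (C (C a)) = C a`, `φ X = X`, `ker φ = (f)`, `ι = PowerSeries.map C`.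
* `smul_eq_self_of_map_eq_one` — `r • x = x` on `M ⧸ fM` whenever `φ r = 1` (`r − 1 ∈ ker φ = (f)`).
* ★ `map_mkQ_Z_eq_span_zetaSp_of_isUnit` — `IsUnit (φ (D.nsub a))` ⟹ `(D.Z).map (f•⊤).mkQ = R∙(zetaSp f D a)` (and `ZSp f D = R∙(zetaSp f D a)`).
  Choice of `𝔞` (JLK §6.1, Rubin §5): `φ(N𝔞 − σ_𝔞)` is a unit iff its constant term `N𝔞 − θ(σ_𝔞)` is a unit of `𝒪`, i.e. `θ ≢ N` on `σ_𝔞` mod `𝔪` — available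
  unless `θ ≡` the cyclotomic character mod `𝔪`.

References: [JohnsonLeungKings2011] §5.2 (independence of `𝔞`, arXiv p0014:L100–105), §6.1; [Rubin1991] §5.
-/

set_option autoImplicit false
-- the Theorems namespace of this sub repeats the summit name by design (D-0017 nested layout)
set_option linter.dupNamespace false

noncomputable section

open scoped Pointwise
open PowerSeries Literature.NumberTheory.ComplexMultiplication.EllipticUnits.JohnsonLeungKings2011
open Summit.BirchSwinnertonDyer.BirchSwinnertonDyer.Theorems.SmallImageRttD2Spec

namespace Summit.BirchSwinnertonDyer.BirchSwinnertonDyer.Theorems.SmallImageRttD2LamSpec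

universe u v

variable {A : Type u} [CommRing A] (b : A) (φ : PowerSeries (PowerSeries A) →+* PowerSeries A)
  (hC : ∀ a : A, φ (C (C a)) = C a) (hX : φ X = X) (hker : RingHom.ker φ = Ideal.span {C (X - C b)})

include hker in
/-- **`r • x = x` on `M ⧸ fM` whenever `φ r = 1`** (`r − 1 ∈ ker φ = (f)` kills `M/fM`). [folklore] -/
theorem smul_eq_self_of_map_eq_one (M : Type v) [AddCommGroup M] [Module (PowerSeries (PowerSeries A)) M]
    {r : PowerSeries (PowerSeries A)} (hr : φ r = 1) (x : QuotSMulTop (C (X - C b) : PowerSeries (PowerSeries A)) M) : r • x = x := by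
  have hmem : r - 1 ∈ RingHom.ker φ := by rw [RingHom.mem_ker, map_sub, hr, map_one, sub_self]
  rw [hker, Ideal.mem_span_singleton] at hmem
  obtain ⟨c, hc⟩ := hmem
  obtain ⟨y, rfl⟩ := Submodule.Quotient.mk_surjective _ x
  have h0 : (r - 1) • (Submodule.Quotient.mk y : QuotSMulTop (C (X - C b) : PowerSeries (PowerSeries A)) M) = 0 := by
    rw [hc, ← Submodule.Quotient.mk_smul, Submodule.Quotient.mk_eq_zero, mul_smul]
    exact Submodule.smul_mem_pointwise_smul _ _ _ Submodule.mem_top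
  rwa [sub_smul, one_smul, sub_eq_zero] at h0

include hC hX hker in
/-- ★ **Cyclic specialised zeta module.** For a `ZetaSkeleton` `D` over `R = 𝒪⟦T₂⟧⟦T₁⟧` and an auxiliary index `a` with `φ (D.nsub a)` a UNIT of `𝒪⟦T⟧`:
the image of `𝒥(ζ) = D.Z` in `H¹ ⧸ fH¹` is generated by the single class `zetaSp f D a` — from the independence relation
`(N𝔟 − σ_𝔟)·_𝔞ζ = (N𝔞 − σ_𝔞)·_𝔟ζ` (`D.aZeta_indep`) and `(v·(N𝔞 − σ_𝔞)) • x = x` on `H¹/fH¹` for `φ v = φ(N𝔞 − σ_𝔞)⁻¹`.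
[cite: JohnsonLeungKings2011, §5.2 (arXiv p0014:L100–105) and §6.1] -/
theorem map_mkQ_Z_eq_span_zetaSp_of_isUnit {Aidx H0 H1 H2 : Type v} [AddCommGroup H0] [Module (PowerSeries (PowerSeries A)) H0]
    [AddCommGroup H1] [Module (PowerSeries (PowerSeries A)) H1] [AddCommGroup H2] [Module (PowerSeries (PowerSeries A)) H2]
    (D : ZetaSkeleton (PowerSeries (PowerSeries A)) Aidx H0 H1 H2) (a : Aidx) (ha : IsUnit (φ (D.nsub a))) :
    (D.Z).map ((C (X - C b) : PowerSeries (PowerSeries A)) • (⊤ : Submodule (PowerSeries (PowerSeries A)) H1)).mkQ =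
      Submodule.span (PowerSeries (PowerSeries A)) {zetaSp (C (X - C b) : PowerSeries (PowerSeries A)) D a} := by
  rw [← ZSp_eq_map]
  refine le_antisymm ?_ (Submodule.span_mono (Set.singleton_subset_iff.mpr ⟨a, rfl⟩))
  refine Submodule.span_le.mpr ?_
  rintro _ ⟨c, rfl⟩
  -- `v` with `φ v = φ(nsub a)⁻¹`
  obtain ⟨w, hw⟩ := ha.exists_left_inv
  set v : PowerSeries (PowerSeries A) := PowerSeries.map (PowerSeries.C : A →+* PowerSeries A) w with hv
  have hv1 : φ (v * D.nsub a) = 1 := by rw [map_mul, hv, map_outer_eq_self_of_clauses' φ hC hX, hw]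
  -- the independence relation in `H¹ ⧸ fH¹`
  have hrel : D.nsub a • zetaSp (C (X - C b) : PowerSeries (PowerSeries A)) D c =
      D.nsub c • zetaSp (C (X - C b) : PowerSeries (PowerSeries A)) D a := by
    change D.nsub a • Submodule.Quotient.mk (D.aZeta c) = D.nsub c • Submodule.Quotient.mk (D.aZeta a)
    rw [← Submodule.Quotient.mk_smul, ← Submodule.Quotient.mk_smul, D.aZeta_indep c a]
  rw [SetLike.mem_coe, ← smul_eq_self_of_map_eq_one b φ hker H1 hv1 (zetaSp _ D c), mul_smul, hrel, ← mul_smul]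
  exact Submodule.smul_mem _ _ (Submodule.mem_span_singleton_self _)

include hC hX hker in
/-- The same in the `ZSp` spelling: `ZSp f D = R∙(zetaSp f D a)` when `φ (D.nsub a)` is a unit. [cite: JohnsonLeungKings2011, §5.2] -/
theorem ZSp_eq_span_zetaSp_of_isUnit {Aidx H0 H1 H2 : Type v} [AddCommGroup H0] [Module (PowerSeries (PowerSeries A)) H0]
    [AddCommGroup H1] [Module (PowerSeries (PowerSeries A)) H1] [AddCommGroup H2] [Module (PowerSeries (PowerSeries A)) H2]
    (D : ZetaSkeleton (PowerSeries (PowerSeries A)) Aidx H0 H1 H2) (a : Aidx) (ha : IsUnit (φ (D.nsub a))) :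
    ZSp (C (X - C b) : PowerSeries (PowerSeries A)) D = Submodule.span (PowerSeries (PowerSeries A)) {zetaSp (C (X - C b) : PowerSeries (PowerSeries A)) D a} := by
  rw [ZSp_eq_map, map_mkQ_Z_eq_span_zetaSp_of_isUnit b φ hC hX hker D a ha]

end Summit.BirchSwinnertonDyer.BirchSwinnertonDyer.Theorems.SmallImageRttD2LamSpec

end
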